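import Literature.AlgebraicGeometry.Resolution.AlterationsNormalizationReduction
import Literature.AlgebraicGeometry.Resolution.StrictNormalCrossingsPoints
import Literature.AlgebraicGeometry.Resolution.RegularLocalRingsUFD
import Literature.AlgebraicGeometry.Resolution.RegularSystemOfParameters
import HarnessLib

/-!
# De Jong's alteration theorem: 4.9, "we may enlarge `Z`"

Topic: `Literature/AlgebraicGeometry/Resolution`. De Jong 1996, 4.9 (p. 67), used at 4.14 ("It
suffices to prove the theorem for the pair `(X, Z ∪ H)`, see 4.9") and 4.22 ("We replace `X` by
`𝒞` and `Z` by `τ₁(Y) ∪ … ∪ τₙ(Y) ∪ f⁻¹(D)`, see 4.4 and 4.9"):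

> "4.9. Assume (iii) and (iv). We may enlarge `Z` on `X`. Indeed, suppose that `Z'` is a closed
> subset of `X` containing `Z` and that we can solve the problem for the pair `(X, Z')` as in the
> theorem. Then the closed subset `φ₁⁻¹(Z)` will have pure codimension 1 in the variety
> `X₁ = X̄₁` and will be contained in the strict normal crossings divisor `φ₁⁻¹(Z')`. It follows
> that `φ₁⁻¹(Z)` is a strict normal crossings divisor."

PROVED here (`DeJong1996.ConclusionGenericallyEtale.of_subset`, `DeJong1996.Conclusion.of_subset`)
for `X` proper over `k` (in particular (iii) projective) and `Z` the support of an effective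
Cartier divisor ((iv)), through:

* `exists_radical_span_singleton_eq_span_prod` — the factorial arithmetic behind "pure
  codimension 1 […] contained in […] It follows": in a unique factorisation domain, if
  `x₁, …, x_r` are pairwise non-associate primes and `γ` is a non-zero non-unit with
  `x₁ ⋯ x_r ∈ √(γ)`, then `√(γ) = (∏_{i ∈ J} x_i)` for a non-empty set `J` of indices (the
  `x_i` dividing `γ`).
* `IsStrictNormalCrossingsDivisor.of_subset_of_isEffectiveCartier` — **a closed subset of a
  strict normal crossings divisor `E` which is the support of an effective Cartier divisor is a
  strict normal crossings divisor**: at `p`, with `E` cut out by `x₁ ⋯ x_r` for a regular system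
  of parameters `x₁, …, x_r, y₁, …, y_e` of the regular (hence factorial, Auslander–Buchsbaum,
  `IsRegularLocalRing.uniqueFactorizationMonoid`, Matsumura Thm. 20.3) local ring `𝒪_{X,p}`,
  the ideal of the support `F` of `D = V(g)` is `√(g)` (Mathlib `vanishingIdeal_support`), and
  `√(g) ⊇ (x₁ ⋯ x_r)` forces `√(g) = (∏_{i∈J} x_i)`; the `x_i` are prime and pairwise
  non-associate since they are part of a minimal basis of `𝔪_p`
  (`isPrime_span_image`, `not_mem_span_image_of_not_mem`, Matsumura Thm. 14.2/14.3).
* 4.9 itself: for `X` proper over `k` the open immersion `j₁ : X₁ → X̄₁` of a solution is an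
  isomorphism (proper, open, `X̄₁` irreducible), so the boundary is empty, `j₁(φ₁⁻¹(Z'))` is a
  strict normal crossings divisor, and `j₁(φ₁⁻¹(Z))` is the support of the pulled-back Cartier
  divisor (`IsEffectiveCartier.comap_of_isDominant`), hence strict normal crossings.

## Sources

* A. J. de Jong, *Smoothness, semi-stability and alterations*, Publ. Math. IHÉS 83 (1996), 2.4
  (p. 55), 4.9 (p. 67), 4.14 (p. 70), 4.22 (p. 74).
* H. Matsumura, *Commutative Ring Theory* (1986), Thm. 14.2, 14.3, 20.3.
* The Stacks Project, Tag 0BI9/0BIA (strict normal crossings).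
-/

noncomputable section

open CategoryTheory CategoryTheory.Limits AlgebraicGeometry TopologicalSpace Topology IsLocalRing

namespace Literature.AlgebraicGeometry.Resolution

universe u

/-! ## Factorial arithmetic: radicals of principal ideals below a product of primes -/

/-- In a unique factorisation domain: if `x₁, …, x_r` are pairwise non-associate primes and `γ`
is a non-zero non-unit with `x₁ ⋯ x_r ∈ √(γ)`, then `√(γ) = (∏_{i ∈ J} x_i)` for the non-empty
set `J` of indices `i` with `x_i ∣ γ`. [folklore] -/
theorem exists_radical_span_singleton_eq_span_prod {R : Type*} [CommRing R] [IsDomain R]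
    [UniqueFactorizationMonoid R] {r : ℕ} (x : Fin r → R) (hprime : ∀ i, Prime (x i))
    (hnassoc : ∀ i j, i ≠ j → ¬ x i ∣ x j) {γ : R} (hγ0 : γ ≠ 0) (hγu : ¬ IsUnit γ)
    (hle : Ideal.span {∏ i, x i} ≤ (Ideal.span {γ}).radical) :
    ∃ J : Finset (Fin r), J.Nonempty ∧ (Ideal.span {γ}).radical = Ideal.span {∏ i ∈ J, x i} := by
  classical
  let J : Finset (Fin r) := Finset.univ.filter fun i => x i ∣ γ
  have hJ : ∀ i, i ∈ J ↔ x i ∣ γ := fun i => by simp [J]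
  -- `γ ∣ (∏ x)^N`
  obtain ⟨N, hN⟩ : ∃ N : ℕ, γ ∣ (∏ i, x i) ^ N := by
    have h := hle (Ideal.mem_span_singleton_self _)
    obtain ⟨N, hN⟩ := h
    exact ⟨N, Ideal.mem_span_singleton.mp hN⟩
  -- every prime factor of `γ` is one of the `x_i`, `i ∈ J`
  have hfac : ∀ q : R, Prime q → q ∣ γ → ∃ i ∈ J, Associated q (x i) := by
    intro q hq hqγ
    have h1 : q ∣ ∏ i, x i := hq.dvd_of_dvd_pow (hqγ.trans hN)
    obtain ⟨i, -, hi⟩ := hq.exists_mem_finset_dvd h1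
    have hassoc : Associated q (x i) := hq.associated_of_dvd (hprime i) hi
    refine ⟨i, (hJ i).mpr (hassoc.symm.dvd.trans hqγ), hassoc⟩
  -- `J` is non-empty: `γ` has a prime factor
  have hJne : J.Nonempty := by
    obtain ⟨q, hq, hqγ⟩ := WfDvdMonoid.exists_irreducible_factor hγu hγ0
    obtain ⟨i, hi, -⟩ := hfac q (UniqueFactorizationMonoid.irreducible_iff_prime.mp hq) hqγ
    exact ⟨i, hi⟩
  refine ⟨J, hJne, le_antisymm ?_ ?_⟩
  · -- `√(γ) ⊆ (∏_J x_i)`: each `x_i`, `i ∈ J`, divides `γ ∣ z^n`, hence `z`; they are coprime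
    intro z hz
    obtain ⟨n, hn⟩ := hz
    have hγz : γ ∣ z ^ n := Ideal.mem_span_singleton.mp hn
    rw [Ideal.mem_span_singleton]
    refine Finset.prod_dvd_of_isRelPrime ?_ fun i hi => ?_
    · intro i _ j _ hij
      exact ((hprime i).irreducible.isRelPrime_iff_not_dvd).mpr (hnassoc i j hij)
    · exact (hprime i).dvd_of_dvd_pow (((hJ i).mp hi).trans hγz)
  · -- `(∏_J x_i) ⊆ √(γ)`: `γ ∣ (∏_J x_i)^n` by induction over the prime factorisation of `γ`
    rw [Ideal.span_singleton_le_iff_mem]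
    suffices h : ∀ a : R, a ∣ γ → ∃ n : ℕ, a ∣ (∏ i ∈ J, x i) ^ n by
      obtain ⟨n, hn⟩ := h γ dvd_rfl
      exact ⟨n, Ideal.mem_span_singleton.mpr hn⟩
    intro a
    refine UniqueFactorizationMonoid.induction_on_prime a ?_ ?_ ?_
    · intro h0
      exact absurd (zero_dvd_iff.mp h0) hγ0
    · intro u hu _
      exact ⟨0, hu.dvd⟩
    · intro a q _ hq ih hqa
      obtain ⟨n, hn⟩ := ih ((dvd_mul_left a q).trans hqa)
      obtain ⟨i, hi, hassoc⟩ := hfac q hq ((dvd_mul_right q a).trans hqa)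
      refine ⟨n + 1, ?_⟩
      rw [pow_succ']
      exact mul_dvd_mul (hassoc.dvd.trans (Finset.dvd_prod_of_mem _ hi)) hn

/-! ## Regular systems of parameters: the members are pairwise non-associate primes -/

section Rsop

variable {R : Type u} [CommRing R] [IsRegularLocalRing R] {d : ℕ} (z : Fin d → R)
  (hz : Ideal.span (Set.range z) = maximalIdeal R) (hdim : ringKrullDim R = (d : ℕ))

include hz hdim

omit hz in
/-- A regular local ring of dimension `d` has embedding dimension `d` (so that `d` generators
of `𝔪` form a minimal basis). [folklore] -/
theorem spanFinrank_maximalIdeal_eq_of_ringKrullDim_eq : (maximalIdeal R).spanFinrank = d := by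
  have h := IsRegularLocalRing.spanFinrank_maximalIdeal (R := R)
  rw [hdim] at h
  exact_mod_cast h

/-- A member of a regular system of parameters is non-zero. [folklore] -/
theorem ne_zero_of_rsop (i : Fin d) : z i ≠ 0 := by
  intro h0
  have := not_mem_span_image_of_not_mem (spanFinrank_maximalIdeal_eq_of_ringKrullDim_eq hdim) z hz
    (S := ∅) (i := i) (Set.notMem_empty i)
  apply this
  rw [h0]
  exact Ideal.zero_mem _

/-- **A member of a regular system of parameters is a prime element** (Matsumura, Thm. 14.2
with 14.3: `A/(x_i)` is regular, hence a domain). [cite: Matsumura1987, Thm. 14.2 and 14.3] -/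
theorem prime_of_rsop (i : Fin d) : Prime (z i) := by
  classical
  have h := isPrime_span_image (spanFinrank_maximalIdeal_eq_of_ringKrullDim_eq hdim) z hz {i}
  rw [Finset.coe_singleton, Set.image_singleton] at h
  exact (Ideal.span_singleton_prime (ne_zero_of_rsop z hz hdim i)).mp h

/-- Distinct members of a regular system of parameters do not divide each other (minimality of
the basis, Matsumura Thm. 14.2). [cite: Matsumura1987, Thm. 14.2] -/
theorem not_dvd_of_rsop {i j : Fin d} (hij : i ≠ j) : ¬ z i ∣ z j := by
  intro hdvd
  have := not_mem_span_image_of_not_mem (spanFinrank_maximalIdeal_eq_of_ringKrullDim_eq hdim) z hz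
    (S := {i}) (i := j) (by simpa using hij.symm)
  apply this
  rw [Set.image_singleton]
  exact Ideal.mem_span_singleton.mpr hdvd

end Rsop

/-- The range of `Fin.append u v` is the union of the ranges. [folklore] -/
theorem range_fin_append {α : Type*} {m n : ℕ} (u : Fin m → α) (v : Fin n → α) :
    Set.range (Fin.append u v) = Set.range u ∪ Set.range v := by
  ext a
  constructor
  · rintro ⟨i, rfl⟩
    refine Fin.addCases (fun j => ?_) (fun j => ?_) i
    · exact Or.inl ⟨j, (Fin.append_left u v j).symm⟩
    · exact Or.inr ⟨j, (Fin.append_right u v j).symm⟩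
  · rintro (⟨j, rfl⟩ | ⟨j, rfl⟩)
    · exact ⟨Fin.castAdd n j, Fin.append_left u v j⟩
    · exact ⟨Fin.natAdd m j, Fin.append_right u v j⟩

/-! ## A Cartier divisor inside a strict normal crossings divisor is strict normal crossings -/

open Scheme.IdealSheafData in
/-- **A closed subset of a strict normal crossings divisor which is the support of an effective
Cartier divisor is a strict normal crossings divisor** (the content of de Jong 1996, 4.9: "the
closed subset `φ₁⁻¹(Z)` will have pure codimension 1 […] and will be contained in the strict
normal crossings divisor `φ₁⁻¹(Z')`. It follows that `φ₁⁻¹(Z)` is a strict normal crossings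
divisor"). At `p ∈ F ⊆ E`: `𝒪_{X,p}` is regular, hence factorial; `E` is cut out by
`x₁ ⋯ x_r` for a regular system of parameters `x, y`; the ideal of `F = Supp 𝒪/(g)` at `p` is
`√(g) ⊇ (x₁ ⋯ x_r)`, so `√(g) = (∏_{i ∈ J} x_i)` with `J ≠ ∅`, and `(x_J ; x_{Jᶜ}, y)` is the
required regular system of parameters for `F`. [cite: DeJong1996, 4.9, p. 67] -/
theorem IsStrictNormalCrossingsDivisor.of_subset_of_isEffectiveCartier {X : Scheme.{u}}
    {E F : Set X} (hE : IsStrictNormalCrossingsDivisor X E) (hFE : F ⊆ E) {D : X.IdealSheafData}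
    (hD : IsEffectiveCartier D) (hDF : (D.support : Set X) = F) :
    IsStrictNormalCrossingsDivisor X F := by
  classical
  rw [isStrictNormalCrossingsDivisor_iff_stalkIdeal] at hE ⊢
  obtain ⟨-, hE⟩ := hE
  have hFcl : IsClosed F := hDF ▸ D.support.isClosed
  refine ⟨hFcl, fun p hp => ?_⟩
  obtain ⟨hreg, r, e, x, y, hr, hdim, hspan, hIE⟩ := hE p (hFE hp)
  haveI := hreg
  haveI := isDomain_of_isRegularLocalRing (X.presheaf.stalk p)
  haveI : UniqueFactorizationMonoid (X.presheaf.stalk p) :=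
    IsRegularLocalRing.uniqueFactorizationMonoid _
  refine ⟨hreg, ?_⟩
  -- the vanishing ideal sheaf of `F` is the radical of `D`
  have hIF : vanishingIdeal ⟨closure F, isClosed_closure⟩ = D.radical := by
    have : (⟨closure F, isClosed_closure⟩ : Closeds X) = D.support :=
      Closeds.ext (show closure F = (D.support : Set X) from hFcl.closure_eq.trans hDF.symm)
    rw [this, vanishingIdeal_support]
  have hle : vanishingIdeal ⟨closure E, isClosed_closure⟩ ≤
      vanishingIdeal ⟨closure F, isClosed_closure⟩ :=
    vanishingIdeal_antimono (show ((⟨closure F, isClosed_closure⟩ : Closeds X) : Set X) ⊆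
      (⟨closure E, isClosed_closure⟩ : Closeds X) from closure_mono hFE)
  -- a Cartier chart of `D` at `p`: `D(U) = (g)`, `g` regular; `γ` its germ
  obtain ⟨U, hpU, g, hg, hDU⟩ := hD p
  letI := TopCat.Presheaf.algebra_section_stalk X.presheaf (⟨p, hpU⟩ : (U : X.Opens))
  haveI := U.2.isLocalization_stalk ⟨p, hpU⟩
  set γ : X.presheaf.stalk p := (X.presheaf.germ U p hpU).hom g with hγdef
  have hstalkD : stalkIdeal D p = Ideal.span {γ} := by
    rw [stalkIdeal_eq_map_germ D U hpU, hDU, Ideal.map_span, Set.image_singleton]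
  have hstalkF : stalkIdeal (vanishingIdeal ⟨closure F, isClosed_closure⟩) p =
      (Ideal.span {γ}).radical := by
    rw [hIF, stalkIdeal_eq_map_germ _ U hpU, ← hstalkD, stalkIdeal_eq_map_germ D U hpU]
    simp only [Scheme.IdealSheafData.radical_ideal]
    exact IsLocalization.map_radical (U.2.primeIdealOf ⟨p, hpU⟩).asIdeal.primeCompl
      (X.presheaf.stalk p) (D.ideal U)
  -- `γ ≠ 0` (the germ of a regular element) and `γ ∈ 𝔪_p` (`p ∈ Supp D`)
  have hγ0 : γ ≠ 0 := by
    intro h0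
    obtain ⟨⟨m, hm⟩, hmg⟩ := (IsLocalization.map_eq_zero_iff
      (U.2.primeIdealOf ⟨p, hpU⟩).asIdeal.primeCompl (X.presheaf.stalk p) g).mp h0
    have hm0 : m = 0 := (mem_nonZeroDivisors_iff_right.mp hg) m hmg
    apply hm
    rw [hm0]
    exact Ideal.zero_mem _
  have hγm : γ ∈ maximalIdeal (X.presheaf.stalk p) := by
    have hpD : p ∈ D.support := by
      rw [← SetLike.mem_coe, hDF]
      exact hp
    have := (mem_support_iff_stalkIdeal_le D p).mp hpD
    rw [hstalkD, Ideal.span_singleton_le_iff_mem] at this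
    exact this
  have hγu : ¬ IsUnit γ := (IsLocalRing.mem_maximalIdeal _).mp hγm
  -- `(x₁ ⋯ x_r) ⊆ √(γ)`
  have hprod : Ideal.span {∏ i, x i} ≤ (Ideal.span {γ}).radical := by
    rw [← hIE, ← hstalkF]
    exact stalkIdeal_mono hle p
  -- the `x_i` are pairwise non-associate primes: `(x, y)` is a regular system of parameters
  let z : Fin (r + e) → X.presheaf.stalk p := Fin.append x y
  have hz : Ideal.span (Set.range z) = maximalIdeal (X.presheaf.stalk p) := by
    rw [range_fin_append]
    exact hspan
  have hxz : ∀ i : Fin r, x i = z (Fin.castAdd e i) := fun i => (Fin.append_left x y i).symm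
  have hprime : ∀ i, Prime (x i) := fun i => by
    rw [hxz]
    exact prime_of_rsop z hz hdim _
  have hnassoc : ∀ i j, i ≠ j → ¬ x i ∣ x j := fun i j hij => by
    rw [hxz, hxz]
    exact not_dvd_of_rsop z hz hdim fun h => hij (Fin.castAdd_injective _ _ h)
  -- factorial arithmetic
  obtain ⟨J, hJne, hrad⟩ :=
    exists_radical_span_singleton_eq_span_prod x hprime hnassoc hγ0 hγu hprod
  -- the new regular system of parameters `(x_J ; x_{Jᶜ}, y)`
  have hJc : Jᶜ.card = r - J.card := by rw [Finset.card_compl, Fintype.card_fin]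
  let eJ : Fin J.card ≃o J := J.orderIsoOfFin rfl
  let eJc : Fin (r - J.card) ≃o (Jᶜ : Finset (Fin r)) := Jᶜ.orderIsoOfFin hJc
  let x' : Fin J.card → X.presheaf.stalk p := fun k => x (eJ k)
  let y' : Fin ((r - J.card) + e) → X.presheaf.stalk p := Fin.append (fun k => x (eJc k)) y
  have hJr : J.card ≤ r := (J.card_le_univ).trans_eq (Fintype.card_fin r)
  refine ⟨J.card, (r - J.card) + e, x', y', hJne.card_pos, ?_, ?_, ?_⟩
  · have hnat : J.card + ((r - J.card) + e) = r + e := by omega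
    rw [hnat]
    exact hdim
  · -- same generating set
    rw [← hspan]
    congr 1
    apply Set.Subset.antisymm
    · rintro a (⟨k, rfl⟩ | ⟨k, rfl⟩)
      · exact Or.inl ⟨_, rfl⟩
      · refine Fin.addCases (fun j => ?_) (fun j => ?_) k
        · left
          exact ⟨(eJc j : Fin r), (Fin.append_left (fun k => x (eJc k)) y j).symm⟩
        · right
          exact ⟨j, (Fin.append_right (fun k => x (eJc k)) y j).symm⟩
    · rintro a (⟨i, rfl⟩ | ⟨j, rfl⟩)
      · by_cases hi : i ∈ J
        · left
          refine ⟨eJ.symm ⟨i, hi⟩, ?_⟩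
          simp [x']
        · right
          have hi' : i ∈ Jᶜ := Finset.mem_compl.mpr hi
          refine ⟨Fin.castAdd e (eJc.symm ⟨i, hi'⟩), ?_⟩
          simp only [y', Fin.append_left]
          simp
      · right
        exact ⟨Fin.natAdd _ j, Fin.append_right (fun k => x (eJc k)) y j⟩
  · -- the ideal of `F` at `p` is `(∏_{k} x'_k) = (∏_{i ∈ J} x_i)`
    rw [hstalkF, hrad]
    congr 2
    rw [← Finset.prod_coe_sort J x]
    exact (Fintype.prod_equiv eJ.toEquiv (fun k => x (eJ k)) (fun i : J => x i) fun k => rfl).symm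

/-! ## 4.9: enlarging `Z` -/

namespace DeJong1996

/-- **de Jong 1996, 4.9: "We may enlarge `Z` on `X`"**, with the generically-étale clause. For
`X` proper over `k` ((iii)) and `Z` the support of an effective Cartier divisor ((iv)): if
`Z ⊆ Z'` and the conclusion of Thm. 4.1 holds for `(X, Z')`, it holds for `(X, Z)`, with the
same data `(X₁, X̄₁, φ₁, j₁)`. Indeed `j₁ : X₁ → X̄₁` is then an isomorphism (a proper open
immersion into an irreducible scheme: "`X₁ = X̄₁`"), so the boundary is empty, `j₁(φ₁⁻¹(Z'))` is a
strict normal crossings divisor, and `j₁(φ₁⁻¹(Z))` is the support of the Cartier divisor pulled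
back along `φ₁` and `j₁⁻¹` (`IsEffectiveCartier.comap_of_isDominant`) contained in it, hence a
strict normal crossings divisor (`IsStrictNormalCrossingsDivisor.of_subset_of_isEffectiveCartier`).
[cite: DeJong1996, 4.9, p. 67] -/
theorem ConclusionGenericallyEtale.of_subset {k : Type u} [Field k] {X : Scheme.{u}}
    {f : X ⟶ Spec (.of k)} [IsIntegral X] [IsProper f] {Z Z' : Set X} (hZZ' : Z ⊆ Z')
    (hD : ∃ D : X.IdealSheafData, IsEffectiveCartier D ∧ (D.support : Set X) = Z)
    (h : ConclusionGenericallyEtale f Z') : ConclusionGenericallyEtale f Z := by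
  obtain ⟨X₁, Xbar₁, φ₁, j₁, g, hφ, hj, hint, hproj, hreg, hcomm, hsnc, het⟩ := h
  haveI := hφ.isIntegral
  haveI := hφ.isProper
  haveI := hj
  haveI := hint
  haveI : IsDominant φ₁ := hφ.isDominant
  haveI : IsProper g := Motives.IsProjectiveOver.isProper hproj
  -- `j₁` is proper, with closed and open non-empty range in the irreducible `X̄₁`: an isomorphism
  haveI : IsProper (j₁ ≫ g) := by rw [hcomm]; infer_instance
  haveI : IsProper j₁ := IsProper.of_comp j₁ g
  have hrange : Set.range j₁ = Set.univ := by
    have hcl : IsClosed (Set.range j₁) := j₁.isClosedMap.isClosed_range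
    have hne : (Set.range j₁).Nonempty := ⟨_, ⟨Classical.arbitrary X₁, rfl⟩⟩
    have hdense : Dense (Set.range j₁) := j₁.isOpenEmbedding.isOpen_range.dense hne
    rw [← hdense.closure_eq, hcl.closure_eq]
  haveI : IsIso j₁ := by
    haveI : Epi j₁.base := (TopCat.epi_iff_surjective _).mpr (Set.range_eq_univ.mp hrange)
    exact IsOpenImmersion.isIso j₁
  have hcompl : (Set.range j₁)ᶜ = ∅ := by rw [hrange, Set.compl_univ]
  rw [hcompl, Set.union_empty] at hsnc
  -- `j₁(φ₁⁻¹ Z)` is the support of an effective Cartier divisor on `X̄₁`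
  obtain ⟨D, hDc, hDZ⟩ := hD
  have hD₁ : IsEffectiveCartier ((D.comap φ₁).comap (inv j₁)) :=
    (hDc.comap_of_isDominant φ₁).comap_of_isDominant (inv j₁)
  have hsupp : (((D.comap φ₁).comap (inv j₁)).support : Set Xbar₁) = j₁ '' (φ₁ ⁻¹' Z) := by
    rw [Scheme.IdealSheafData.support_comap, Closeds.coe_preimage,
      Scheme.IdealSheafData.support_comap, Closeds.coe_preimage, hDZ]
    ext y
    constructor
    · intro hy
      refine ⟨inv j₁ y, hy, ?_⟩
      rw [← Scheme.Hom.comp_apply, IsIso.inv_hom_id]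
      rfl
    · rintro ⟨x, hx, rfl⟩
      show inv j₁ (j₁ x) ∈ φ₁ ⁻¹' Z
      rw [← Scheme.Hom.comp_apply, IsIso.hom_inv_id]
      exact hx
  have hsncZ : IsStrictNormalCrossingsDivisor Xbar₁ (j₁ '' (φ₁ ⁻¹' Z)) :=
    hsnc.of_subset_of_isEffectiveCartier (Set.image_mono (Set.preimage_mono hZZ')) hD₁ hsupp
  refine ⟨X₁, Xbar₁, φ₁, j₁, g, hφ, hj, hint, hproj, hreg, hcomm, ?_, het⟩
  rwa [hcompl, Set.union_empty]

/-- **de Jong 1996, 4.9** for the conclusion of Thm. 4.1 without the generically-étale clause.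
[cite: DeJong1996, 4.9, p. 67] -/
theorem Conclusion.of_subset {k : Type u} [Field k] {X : Scheme.{u}} {f : X ⟶ Spec (.of k)}
    [IsIntegral X] [IsProper f] {Z Z' : Set X} (hZZ' : Z ⊆ Z')
    (hD : ∃ D : X.IdealSheafData, IsEffectiveCartier D ∧ (D.support : Set X) = Z)
    (h : Conclusion f Z') : Conclusion f Z := by
  obtain ⟨X₁, Xbar₁, φ₁, j₁, g, hφ, hj, hint, hproj, hreg, hcomm, hsnc⟩ := h
  haveI := hφ.isIntegral
  haveI := hφ.isProper
  haveI := hj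
  haveI := hint
  haveI : IsDominant φ₁ := hφ.isDominant
  haveI : IsProper g := Motives.IsProjectiveOver.isProper hproj
  haveI : IsProper (j₁ ≫ g) := by rw [hcomm]; infer_instance
  haveI : IsProper j₁ := IsProper.of_comp j₁ g
  have hrange : Set.range j₁ = Set.univ := by
    have hcl : IsClosed (Set.range j₁) := j₁.isClosedMap.isClosed_range
    have hne : (Set.range j₁).Nonempty := ⟨_, ⟨Classical.arbitrary X₁, rfl⟩⟩
    have hdense : Dense (Set.range j₁) := j₁.isOpenEmbedding.isOpen_range.dense hne
    rw [← hdense.closure_eq, hcl.closure_eq]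
  haveI : IsIso j₁ := by
    haveI : Epi j₁.base := (TopCat.epi_iff_surjective _).mpr (Set.range_eq_univ.mp hrange)
    exact IsOpenImmersion.isIso j₁
  have hcompl : (Set.range j₁)ᶜ = ∅ := by rw [hrange, Set.compl_univ]
  rw [hcompl, Set.union_empty] at hsnc
  obtain ⟨D, hDc, hDZ⟩ := hD
  have hD₁ : IsEffectiveCartier ((D.comap φ₁).comap (inv j₁)) :=
    (hDc.comap_of_isDominant φ₁).comap_of_isDominant (inv j₁)
  have hsupp : (((D.comap φ₁).comap (inv j₁)).support : Set Xbar₁) = j₁ '' (φ₁ ⁻¹' Z) := by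
    rw [Scheme.IdealSheafData.support_comap, Closeds.coe_preimage,
      Scheme.IdealSheafData.support_comap, Closeds.coe_preimage, hDZ]
    ext y
    constructor
    · intro hy
      refine ⟨inv j₁ y, hy, ?_⟩
      rw [← Scheme.Hom.comp_apply, IsIso.inv_hom_id]
      rfl
    · rintro ⟨x, hx, rfl⟩
      show inv j₁ (j₁ x) ∈ φ₁ ⁻¹' Z
      rw [← Scheme.Hom.comp_apply, IsIso.hom_inv_id]
      exact hx
  have hsncZ : IsStrictNormalCrossingsDivisor Xbar₁ (j₁ '' (φ₁ ⁻¹' Z)) :=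
    hsnc.of_subset_of_isEffectiveCartier (Set.image_mono (Set.preimage_mono hZZ')) hD₁ hsupp
  refine ⟨X₁, Xbar₁, φ₁, j₁, g, hφ, hj, hint, hproj, hreg, hcomm, ?_⟩
  rwa [hcompl, Set.union_empty]

end DeJong1996

end Literature.AlgebraicGeometry.Resolution

end
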